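import Literature.Computability.Complexity.NumPrograms
import Literature.Computability.Complexity.StackRadixSort
import HarnessLib

/-!
# Numeric register programs, III: the sorting opcode

Literature / complexity toolkit, continuing `NumPrograms.lean` (the language `NCom`, extension
opcodes `NExt` with their soundness `NExt.Sound`) and `StackRadixSort.lean` (the verified LSD
radix sorter `Radix.sortProg` on its register file `RRF`, **`Radix.runs_sortProg`**).  The
baby-step/giant-step matching of Harvey's factoring algorithm (Harvey 2021, Algorithm 4.2,
step 3: "applying a sort-and-match algorithm") sorts lists of `N^{1/5+o(1)}` residues; this
file makes the tree's sorter available to numeric programs as an extension opcode, and is the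
first instance of the extension mechanism:

* `NExt.sortSem (v, b)` — the meaning: the queue `v` is replaced by the radix-sorted
  permutation of itself with key width `size b` (`radixSortNat`), `steps += |v| + 1`, `peak`
  unchanged; **`radixSortNat_sorted`**: if every entry is `< 2 ^ size b` (i.e. at most the
  value of `b` in size) the result is the `≤`-sorted permutation;
* `NExt.sortCom ι (v, b)` — the code: move the queue into the sorter's bank (embedded into the
  extension bank `X` by `ι : RReg ↪ X`), put up the unary key width, run `sortProg` renamed
  into the big register file, clean up, move the result back;
* `NExt.sort ι : NExt S V O X (V × S)` and **`NExt.sort_sound`**: the opcode is sound with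
  constant `KSort = 512` (its machine cost is `O(|v| · w²)` for `w` the bit size of `peak`,
  within `K · (|v| + 1) · (w + 2)³`);
* `NExt.sum` / `NExt.Sound.sum` — combining two extensions (for programs using several bricks).

## References

* D. E. Knuth, *The Art of Computer Programming*, Vol. 3, 2nd ed., Addison–Wesley 1998, §5.2.5
  (LSD radix sorting; the sorter of `StackRadixSort.lean`). (Folklore, fully proved there.)
* D. Harvey, *An exponent one-fifth algorithm for deterministic integer factorisation*, Math.
  Comp. 90 (2021), §2 ("we may sort … using merge sort in time O(n β lg n)") and Algorithm 4.2
  step 3 [Harvey2021].  (Any `O(n β polylog)` sorter serves; the tree's is radix sort.)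
-/

namespace Literature.Computability.Complexity

open _root_.Computability SProg NBank

/-! ### Sorting numerals by radix sort -/

/-- The radix sorter applied to a list of naturals through their numerals, key width `k`.
[folklore] -/
def radixSortNat (k : ℕ) (l : List ℕ) : List ℕ := (radixIter (l.map encodeNat) k).map bitsToNat

/-- The sorted words are numerals of the entries. [folklore] -/
theorem radixIter_map_encodeNat_mem {k : ℕ} {l : List ℕ} {w : List Bool} (hw : w ∈ radixIter (l.map encodeNat) k) :
    ∃ x ∈ l, encodeNat x = w := by
  have := (radixIter_perm (l.map encodeNat) k).subset hw
  simpa using this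

/-- Re-coding the sorted words gives them back. [folklore] -/
theorem map_encodeNat_radixSortNat (k : ℕ) (l : List ℕ) :
    (radixSortNat k l).map encodeNat = radixIter (l.map encodeNat) k := by
  unfold radixSortNat
  rw [List.map_map]
  conv_rhs => rw [← List.map_id (radixIter (l.map encodeNat) k)]
  refine List.map_congr_left fun w hw => ?_
  obtain ⟨x, -, rfl⟩ := radixIter_map_encodeNat_mem hw
  simp

/-- `radixSortNat` permutes. [folklore] -/
theorem radixSortNat_perm (k : ℕ) (l : List ℕ) : (radixSortNat k l).Perm l := by
  have h := (radixIter_perm (l.map encodeNat) k).map bitsToNat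
  rw [List.map_map] at h
  have e : (bitsToNat ∘ encodeNat) = id := funext fun x => by simp
  rw [e, List.map_id] at h
  exact h

/-- Length of `radixSortNat`. [folklore] -/
theorem length_radixSortNat (k : ℕ) (l : List ℕ) : (radixSortNat k l).length = l.length :=
  (radixSortNat_perm k l).length_eq

/-- **The opcode sorts**: if every entry has at most `k` bits, `radixSortNat k l` is sorted.
[Knuth 1998, §5.2.5] [folklore] -/
theorem radixSortNat_sorted {k : ℕ} {l : List ℕ} (h : ∀ x ∈ l, x < 2 ^ k) :
    (radixSortNat k l).Pairwise (· ≤ ·) := by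
  unfold radixSortNat
  rw [List.pairwise_map]
  refine sorted_radixIter_of_length_le _ fun v hv => ?_
  obtain ⟨x, hx, rfl⟩ : ∃ x ∈ l, encodeNat x = v := by simpa using hv
  rw [TM2Pass.length_encodeNat_eq_size]
  exact Nat.size_le.2 (h x hx)

/-! ### Combining extensions -/

namespace NExt

variable {S V O X : Type}

/-- The sum of two extensions: opcodes of either. [folklore] -/
def sum {E₁ E₂ : Type} (𝓔₁ : NExt S V O X E₁) (𝓔₂ : NExt S V O X E₂) : NExt S V O X (E₁ ⊕ E₂) where
  com := Sum.elim 𝓔₁.com 𝓔₂.com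
  sem := Sum.elim 𝓔₁.sem 𝓔₂.sem
  pre := Sum.elim 𝓔₁.pre 𝓔₂.pre

variable [DecidableEq S] [DecidableEq V] [DecidableEq O] [DecidableEq X]

/-- Soundness with a larger constant. [folklore] -/
theorem Sound.of_le {E : Type} {𝓔 : NExt S V O X E} {K K' : ℕ} (h : 𝓔.Sound K) (hK : K ≤ K') : 𝓔.Sound K' :=
  ⟨h.wf, h.mono, fun e σ κ hσ hp => (h.runs e σ κ hσ hp).mono (Nat.mul_le_mul_right _ (Nat.mul_le_mul_right _ hK))⟩

/-- The sum of sound extensions is sound (with the larger constant). [folklore] -/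
theorem Sound.sum {E₁ E₂ : Type} {𝓔₁ : NExt S V O X E₁} {𝓔₂ : NExt S V O X E₂} {K₁ K₂ : ℕ}
    (h₁ : 𝓔₁.Sound K₁) (h₂ : 𝓔₂.Sound K₂) : (𝓔₁.sum 𝓔₂).Sound (max K₁ K₂) := by
  have g₁ := h₁.of_le (le_max_left K₁ K₂)
  have g₂ := h₂.of_le (le_max_right K₁ K₂)
  refine ⟨fun e => ?_, fun e => ?_, fun e => ?_⟩ <;> cases e with
  | inl e => first | exact g₁.wf e | exact g₁.mono e | exact g₁.runs e
  | inr e => first | exact g₂.wf e | exact g₂.mono e | exact g₂.runs e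

end NExt

/-! ### The sorting opcode -/

namespace NExt

variable {S V O X : Type} [DecidableEq S] [DecidableEq V] [DecidableEq O] [DecidableEq X] (ι : RReg ↪ X)

/-- The meaning of `sort (v, b)`: the queue `v` becomes its radix-sorted permutation with key
width `size b`; `|v| + 1` units of work. [folklore] -/
def sortSem (p : V × S) (σ : NState S V O) : NState S V O :=
  (σ.setVi p.1 (radixSortNat (σ.sc p.2).size (σ.vi p.1))).bump 0 ((σ.vi p.1).length + 1)

/-- The layer name of the sorter's register `r`. -/
local notation "⟪" r "⟫" => (Sum.inr r : EReg ⊕ NBank S V O X)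

/-- The renaming of the sorter's registers into the big register file. [folklore] -/
def sortMap (r : RReg) : EReg ⊕ NBank S V O X := ⟪rX (ι r)⟫

omit [DecidableEq S] [DecidableEq V] [DecidableEq O] [DecidableEq X] in
/-- The renaming is injective. [folklore] -/
theorem sortMap_injective : Function.Injective (sortMap (S := S) (V := V) (O := O) ι) := by
  intro a b h
  simpa [sortMap] using h

/-- The code of `sort (v, b)`. [folklore] -/
def sortCom (p : V × S) : Com (EReg ⊕ NBank S V O X) :=
  Com.move ⟪rV p.1⟫ ⟪rX (ι .L)⟫ (Com.ra .s) ;;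
  Com.nLen (rW .scr) (rS p.2) (rW .tok) ;;
  Com.nToUnary (rX (ι .W)) (rW .scr) ;;
  Com.clear ⟪rW .scr⟫ ;;
  Radix.sortProg.map (sortMap ι) ;;
  Com.clear ⟪rX (ι .U)⟫ ;;
  Com.move ⟪rX (ι .L)⟫ ⟪rV p.1⟫ (Com.ra .s)

/-- **The sorting extension** (no precondition: the sorter is correct on every state).
[folklore] -/
def sort : NExt S V O X (V × S) where
  com := sortCom ι
  sem := sortSem
  pre := fun _ _ => True

/-- The constant of the sorting opcode. [folklore] -/
def KSort : ℕ := 512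

/-- Runs are preserved by injective renaming (the `Runs` form of `Com.Exec.map`). [folklore] -/
theorem runs_map {ι' κ : Type} [DecidableEq ι'] [DecidableEq κ] {f : ι' → κ} (hf : Function.Injective f)
    {c : Com ι'} {R R' : Regs ι'} {B : ℕ} (h : Com.Runs c R R' B) (T : Regs κ) (hT : ∀ i, T (f i) = R i) :
    Com.Runs (c.map f) T (Com.graft T f R') B := by
  obtain ⟨t, ht, e⟩ := h; exact ⟨t, ht, e.map hf T hT⟩

omit [DecidableEq S] [DecidableEq V] [DecidableEq O] [DecidableEq X] in
/-- The length of the code of a permuted list. [folklore] -/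
theorem length_encList_perm {l l' : List (List Bool)} (h : l.Perm l') : (encList l).length = (encList l').length := by
  rw [length_encList, length_encList, (h.map _).sum_eq]

omit [DecidableEq S] [DecidableEq V] [DecidableEq O] [DecidableEq X] in
/-- The sorter's pass cost on numerals of numbers below `peak`. [folklore] -/
theorem passCost_le {k w : ℕ} {l : List ℕ} (hk : k ≤ w) (hl : ∀ x ∈ l, (encodeNat x).length ≤ w) :
    Radix.passCost k (l.map encodeNat) ≤ l.length * (33 * w + 30) + 6 := by
  unfold Radix.passCost
  rw [List.map_map]
  refine Nat.add_le_add_right ?_ 6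
  have : ∀ x ∈ l, ((fun v => 21 * v.length + 12 * k + 30) ∘ encodeNat) x ≤ 33 * w + 30 := by
    intro x hx; have := hl x hx; simp only [Function.comp_apply]; nlinarith
  calc (l.map ((fun v => 21 * v.length + 12 * k + 30) ∘ encodeNat)).sum ≤ (l.map fun _ => 33 * w + 30).sum :=
        List.sum_le_sum fun x hx => this x hx
    _ = l.length * (33 * w + 30) := by rw [List.map_const', List.sum_replicate, smul_eq_mul]

/-- **Soundness of the sorting extension.** [folklore] -/
theorem sort_sound : (sort (S := S) (V := V) (O := O) ι).Sound KSort := by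
  refine ⟨fun p σ hσ => ?_, fun p σ => NState.mono_bump _ _ _, fun p σ κ hσ _ => ?_⟩
  · exact (hσ.setVi p.1 fun a ha => hσ.vi_le p.1 a ((radixSortNat_perm _ _).subset ha)).bump 0 _
  obtain ⟨v, b⟩ := p
  show Com.Runs (sortCom ι (v, b)) _ _ _
  simp only [sort, sortSem, sortCom]
  -- names
  set l := σ.vi v with hl
  set k := (σ.sc b).size with hk
  set w := σ.peak.size with hw
  set T := (NState.outer κ σ : Regs (NBank S V O X)) with hT
  set E := encVec l with hE
  set Ls := encList (radixIter (l.map encodeNat) k) with hLs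
  have hkw : k ≤ w := Nat.size_le_size (hσ.sc_le b)
  have hkk : (encodeNat k).length ≤ w := by
    rw [TM2Pass.length_encodeNat_eq_size]; exact (Nat.size_le.2 (Nat.lt_two_pow_self)).trans hkw
  have hxw : ∀ x ∈ l, (encodeNat x).length ≤ w := fun x hx => NState.length_encodeNat_le_size (hσ.vi_le v x hx)
  have hEl : E.length ≤ l.length * (2 * w + 2) := NState.length_encVec_le_size (hσ.vi_le v)
  have hLsE : Ls.length = E.length := length_encList_perm (radixIter_perm _ _)
  have hLsv : Ls = encVec (radixSortNat k l) := by rw [hLs, encVec, map_encodeNat_radixSortNat]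
  -- 1. move the queue into the sorter's list register
  have h1 := Com.runs_omove (a := rV v) (b := rX (ι .L)) (by simp) T
  simp only [hT, NState.outer_rV, NState.outer_rX, List.append_nil] at h1
  rw [← hT, ← hl, ← hE] at h1
  set T₁ := Function.update (Function.update T (rV v) []) (rX (ι .L)) E with hT₁
  -- 2. the key width in binary
  have hT₁b : T₁ (rS b) = encodeNat (σ.sc b) := by rw [hT₁, Function.update_of_ne (by simp), Function.update_of_ne (by simp), hT]; rfl
  have hT₁s : T₁ (rW .scr) = [] := by rw [hT₁, Function.update_of_ne (by simp), Function.update_of_ne (by simp), hT]; rfl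
  have hT₁t : T₁ (rW .tok) = [] := by rw [hT₁, Function.update_of_ne (by simp), Function.update_of_ne (by simp), hT]; rfl
  have h2 := Com.runs_nLen (dst := rW .scr) (src := rS b) (tmp := rW .tok) (by simp) (by simp) (by simp) T₁ (n := w)
    (by rw [hT₁b]; exact NState.length_encodeNat_le_size (hσ.sc_le b)) (by rw [hT₁s]; exact Nat.zero_le _) hT₁t
  rw [hT₁b, TM2Pass.length_encodeNat_eq_size, ← hk] at h2
  set T₂ := Function.update T₁ (rW .scr) (encodeNat k) with hT₂
  -- 3. the unary key width
  have hT₂W : T₂ (rX (ι .W)) = [] := by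
    rw [hT₂, Function.update_of_ne (by simp), hT₁, Function.update_of_ne (by simp), Function.update_of_ne (by simp), hT]
    · rfl
  have h3 := Com.runs_nToUnary (rX (ι .W)) (rW .scr) T₂ hT₂W
  have hT₂s : T₂ (rW .scr) = encodeNat k := by rw [hT₂, Function.update_self]
  rw [hT₂s, bitsToNat_encodeNat] at h3
  set T₃ := Function.update T₂ (rX (ι .W)) (List.replicate k true) with hT₃
  -- 4. clear the binary width
  have h4 := Com.runs_oclear (rW .scr) T₃
  have hT₃s : T₃ (rW .scr) = encodeNat k := by rw [hT₃, Function.update_of_ne (by simp), hT₂s]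
  rw [hT₃s] at h4
  -- normal form of the file before sorting
  have hT₄ : Function.update T₃ (rW .scr) [] = Function.update T₁ (rX (ι .W)) (List.replicate k true) := by
    rw [hT₃, Function.update_comm (by simp), hT₂, Function.update_idem, show ([] : List Bool) = T₁ (rW .scr) from hT₁s.symm,
      Function.update_eq_self]
  rw [hT₄] at h4
  set T₄ := Function.update T₁ (rX (ι .W)) (List.replicate k true) with hT₄d
  -- 5. the sorter, renamed into the big file
  set ρ₀ : RRF := ⟨E, [], [], [], [], [], [], [], [], List.replicate k true⟩ with hρ₀
  have hS : ∀ r, Com.base T₄ (sortMap ι r) = ρ₀.regs r := by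
    intro r
    simp only [sortMap, Com.nst_inr, hT₄d, hT₁, hρ₀]
    cases r <;> simp [RRF.regs, hT]
  have h5raw := Radix.runs_sortProg k (l.map encodeNat) ρ₀ (by rw [hρ₀, hE]; rfl) rfl rfl rfl rfl rfl rfl rfl rfl rfl
  have h5 := runs_map (sortMap_injective ι) h5raw (Com.base T₄) hS
  -- the final file of the sorter as updates of ours
  have hρ₁ : RRF.regs { ρ₀ with L := encList (radixIter (List.map encodeNat l) k), U := List.replicate k true, W := [] } =
      Function.update (Function.update (Function.update ρ₀.regs .L Ls) .U (List.replicate k true)) .W [] := by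
    simp [hLs]
  rw [hρ₁, Com.graft_update_eq _ (sortMap_injective ι), Com.graft_update_eq _ (sortMap_injective ι),
    Com.graft_update_eq _ (sortMap_injective ι), Com.graft_self _ (sortMap_injective ι) _ hS] at h5
  simp only [sortMap, Com.update_nst_inr] at h5
  set T₅ := Function.update (Function.update (Function.update T₄ (rX (ι .L)) Ls) (rX (ι .U)) (List.replicate k true))
    (rX (ι .W)) [] with hT₅
  -- 6. clear the unary key width left in `U`
  have h6 := Com.runs_oclear (rX (ι .U)) T₅
  have hT₅U : T₅ (rX (ι .U)) = List.replicate k true := by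
    rw [hT₅, Function.update_of_ne (by simp), Function.update_self]
  rw [hT₅U, List.length_replicate] at h6
  set T₆ := Function.update T₅ (rX (ι .U)) [] with hT₆
  -- 7. move the sorted list back
  have h7 := Com.runs_omove (a := rX (ι .L)) (b := rV v) (by simp) T₆
  have hT₆L : T₆ (rX (ι .L)) = Ls := by
    rw [hT₆, Function.update_of_ne (by simp), hT₅, Function.update_of_ne (by simp), Function.update_of_ne (by simp),
      Function.update_self]
  have hT₆v : T₆ (rV v) = [] := by
    rw [hT₆, Function.update_of_ne (by simp), hT₅, Function.update_of_ne (by simp), Function.update_of_ne (by simp),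
      Function.update_of_ne (by simp), hT₄d, Function.update_of_ne (by simp), hT₁, Function.update_of_ne (by simp),
      Function.update_self]
  rw [hT₆L, hT₆v, List.append_nil] at h7
  refine (h1.seq (h2.seq (h3.seq (h4.seq (h5.seq (h6.seq h7)))))).of_eq ?_ ?_
  · -- the final file codes the sorted state
    rw [NState.enc_bump]
    show Com.base _ = Com.base _
    congr 1
    rw [hT₆, hT₅, hT₄d, hT₁, hLsv, ← NState.outer_setVi, ← hT]
    funext x
    by_cases hxv : x = rV v
    · subst hxv; simp
    · rw [Function.update_of_ne hxv]
      by_cases hxL : x = rX (ι .L)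
      · subst hxL; simp [hT]
      · by_cases hxU : x = rX (ι .U)
        · subst hxU; simp [hT]
        · by_cases hxW : x = rX (ι .W)
          · subst hxW; simp [hT]
          · simp [Function.update_of_ne, hxv, hxL, hxU, hxW]
  · -- the cost
    simp only [NState.steps_bump, NState.steps_setVi, NState.peak_bump, NState.peak_setVi, Nat.add_sub_cancel_left,
      Nat.max_zero, KSort]
    rw [← hw]
    have hp := passCost_le hkw hxw
    have hc3 : (encodeNat k).length * (16 * k + 21) + 5 ≤ w * (16 * w + 21) + 5 :=
      Nat.add_le_add_right (Nat.mul_le_mul hkk (by omega)) 5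
    have hc5 : k * (Radix.passCost k (List.map encodeNat l) + 3) + 1 ≤ w * (l.length * (33 * w + 30) + 9) + 1 :=
      Nat.add_le_add_right (Nat.mul_le_mul hkw (by omega)) 1
    rw [hLsE]
    have hmain : 6 * E.length + 2 + (90 * (w + 1) ^ 2 + ((encodeNat k).length * (16 * k + 21) + 5 +
        (2 * (encodeNat k).length + 1 + (k * (Radix.passCost k (List.map encodeNat l) + 3) + 1 + (2 * k + 1 +
        (6 * E.length + 2)))))) ≤ 200 * (l.length + 1) * (w + 2) ^ 2 := by
      nlinarith [hEl, hc3, hc5, hkk, hkw, Nat.zero_le (l.length * w), Nat.zero_le (l.length * w * w), Nat.zero_le (w * w),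
        Nat.zero_le l.length, Nat.zero_le w]
    refine hmain.trans ?_
    have h2 : 200 * (w + 2) ^ 2 ≤ 512 * (w + 2) ^ 3 := by
      rw [pow_succ]; nlinarith [Nat.zero_le ((w + 2) ^ 2)]
    calc 200 * (l.length + 1) * (w + 2) ^ 2 = (l.length + 1) * (200 * (w + 2) ^ 2) := by ring
      _ ≤ (l.length + 1) * (512 * (w + 2) ^ 3) := Nat.mul_le_mul_left _ h2
      _ = 512 * (l.length + 1) * (w + 2) ^ 3 := by ring

end NExt

end Literature.Computability.Complexity
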